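import Summits.BirchSwinnertonDyer.BirchSwinnertonDyer.Theorems.ErratumRoadFiveOpenInputNotRamBDPFrameDescent
import Summits.BirchSwinnertonDyer.BirchSwinnertonDyer.Theorems.ClassRecordThreeUnramifiedFixedByOpen
import Summits.BirchSwinnertonDyer.Rank1Residual.X11b.Three.ValueReciprocityDictionary
import Summits.BirchSwinnertonDyer.Rank1Residual.X11b.BDPRouteHsiehFrame
import Summits.BirchSwinnertonDyer.Rank1Residual.X11b.LambdaSupplyPrime
import Summits.BirchSwinnertonDyer.Rank1Residual.X11b.EmbeddingDatumPrime
import Summits.BirchSwinnertonDyer.Rank1Residual.X11b.HalvesReceptacle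
import Literature.NumberTheory.EllipticCurves.BDPCentralValueReciprocity
import Literature.FieldTheory.AlgClosed.PadicAlgClEquivComplex
import HarnessLib

/-!
# Route `ErratumRoadFive`, crux `OpenInputNotRam` (item stmt-BirchSwinnertonDyer-19282), registered stub
# `stub_bdpDatumNotRam` (H1′: an `R₀`-frame EXISTS at `p ∥ N`) on ALL (¬ram) pairs — semistable OR NOT — from
# TWO refereed named facts, by the general-`p` `R₀`-descent (`ErratumRoadFiveOpenInputNotRamBDPFrameDescent`)

Cell `bsd-stepL` (run/shared/lean/pub/bsd-stepL/), seat `bsd-stepL-nram2` (prover g2, PART 1b row (5)),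
`--supports stmt-BirchSwinnertonDyer-19282`. Sequel of the descent file. g0 landed this stub on the SEMISTABLE (¬ram)
pairs only (`openInputNotRam_stub_bdpDatumNotRam_of_castella2018_of_semistable`, p462154: Castella 2018 Thm. 3.1 stands
under «square-free `N`», arXiv:1704.06608 p. 9) and typed the gap «`Λ_{R₀}`-membership at `p ∥ N` with `N₀`
non-squarefree: not a refereed statement». This file closes the gap WITHOUT new print: the `R₀`-frame is DESCENDED
from Hsieh's `𝓞_{ℂ_p}`-frame (Hsieh 2014 Thm. 1 ∕ 5.6 — every odd `p` split, `p ∥ N` allowed, ANY `N`) using the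
Katz–Hida–Tilouine period `Ω_p ∈ 𝒲^×` and Bertolini–Darmon–Prasanna 2013's central-value reciprocity, exactly as the
cell's crux `HsiehDescentAtThree` does at `p = 3` (desc3-p1, `Theorems/ClassRecordThreeHsiehDescentUnramifiedPeriodItems`).

* `inertialValueReciprocity_of_bdp2013` — at every odd `p` split in `K`: the inertial value reciprocity of
  Castella's interpolation value `bdpInterpolationValue p f 𝔭 χ n Ω`, from the named fact
  `bertoliniDarmonPrasanna2013_centralValue_reciprocity` (BDP13 Thm. 5.5 with its proof: `Aut(ℂ/F)`-reciprocity of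
  `L(f/K,χ,1)/(π^{2n+1}Ω^{4n})`, `F ⊇ K` finite, unramified above every odd prime split in `K`) — T6-OPEN
  (`UnramifiedOpen.exists_level_forall_fixing_rootsOfUnity_apply_symm_eq`, every `p`) makes every inertial `τ` fix
  `ι′⁻¹(F)`, so `σ = ι′τι′⁻¹` fixes `F`; the dictionary `bdpInterpolationValue_exact_of_normalizedValue_exact`
  (`a_p ∈ ℤ`) transports exactness (desc3's `openValueReciprocityAtThree_of_archimedeanReciprocity`, `3 ↦ p`).
* `exists_isBDPLFunction_of_hsieh2014_unrPeriod_of_bdp2013` — AT EVERY CLASSICAL DATUM (`p` odd; `W/ℚ` elliptic with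
  newform `f` of level `N = N_W`, `p ∣ N`, `p² ∤ N`; `K` imaginary quadratic, `d_K` odd, every `ℓ ∣ N` split; `𝔭 ∋ p`
  of degree one induced by `ι′`; `κ` anticyclotomic with generator `γ`): `∃ (Ω_K ≠ 0) (Ω_p ∈ R₀ˣ) (L ∈ R₀⟦T⟧),
  IsBDPLFunction ι′ 𝔭 κ γ f Ω_K Ω_p L` — A206's conclusion WITHOUT A206's `Squarefree N` and `5 ≤ p`, from the two
  named facts: λ-supply `X11b.lambdaSupplyAt` ⟶ Hsieh witness with `Ω_p ∈ R₀ˣ` ⟶ descent. Usable by every X11b ∕ O2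
  consumer of the frame conjunct (route p2's H∃, `R1.IMCEqFrameOnTree`, the `p = 3` class record).
* `openInputNotRam_stub_bdpDatumNotRam_of_hsieh2014_unrPeriod_of_bdp2013` — the registered signature of
  `Cruxes.OpenInputNotRam.Birth.stub_bdpDatumNotRam` VERBATIM (fully qualified; the skeleton-local abbreviation
  `InducesPrimeAt p ι' 𝔭` written out as its body), after the two fact hypotheses; NO `Semistable W`. Proof:
  `f := f_{Dt}`; a datum `ι'` inducing `𝔭` (`exists_datum_forall_mem_iff`); `p ∣ N`, `p² ∤ N` from `Mult`; the frame
  from the previous theorem. The binders `¬ Ram`, `Surj`, `¬ p ∣ d_K`, `¬ p ∣ #𝓞_K^×`, `L(E^{d_K},1) ≠ 0`, `P` are idle.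

HONEST FRAMING: CONDITIONAL theorems (hypotheses = the two refereed named facts, PUBLISHED inputs carried by name,
not discharged in the tree); no definition, no new named fact, no `sorry`; nothing booked (T7); BSD is not proved
for any class; X11b stays CONSTRUCTION-SHAPED; crux 19282 stays OPEN (its deciding content is H3 = (2.4)|¬ram).
NET for the owner ∕ planner: on the registered `R₀` skeleton, H1′ now holds on ALL (¬ram) pairs from PUB facts, so
19282 ⟸ {PUB facts, `stub_imcDivNotRam`} with no semistability proviso.

References: [Hsieh2014] Thm. 1 ∕ Thm. 5.6 (arXiv:1112.1580 pp. 3–4, 23); [CastellaHsieh2018] §2.5;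
[BertoliniDarmonPrasanna2013] Thm. 5.5, (5.1.16), Prop. 1.12 (1), Lemma 5.3; [Castella2018] Thm. 3.1 (arXiv:1704.06608
p. 9); [SerreLocalFields1979] Ch. IV §4 Prop. 16, Cor. 1; [Weil1956] §1.
-/

noncomputable section

set_option linter.dupNamespace false

open scoped Classical NumberField

open NumberField IsDedekindDomain Field WeierstrassCurve
open Literature.NumberTheory.GaloisRepresentations Literature.NumberTheory.EllipticCurves
open Literature.NumberTheory.EllipticCurves.ModularForms Literature.NumberTheory.EllipticCurves.Rank1Residual
open Summit.BirchSwinnertonDyer.Rank1Residual Summit.BirchSwinnertonDyer.Rank1Residual.X11b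
open Summit.BirchSwinnertonDyer.Rank1Residual.X11b.Three

namespace Summit.BirchSwinnertonDyer.BirchSwinnertonDyer.Theorems

/-! ### §1 Inertial value reciprocity at every odd split `p`, from BDP13 -/

section Reciprocity

/-- **Inertial value reciprocity of Castella's interpolation value at every odd prime `p` split in `K`**, from the
named fact `bertoliniDarmonPrasanna2013_centralValue_reciprocity` (BDP13 Thm. 5.5 with its proof): for the newform `f`
of an elliptic `W/ℚ` of conductor `N`, `K` imaginary quadratic of odd discriminant with every `ℓ ∣ N` split and `p`
split, there is `Ω ≠ 0` such that `σ(bdpInterpolationValue p f 𝔭 χ n Ω) = bdpInterpolationValue p f 𝔭 (^σχ) n Ω` for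
every `τ ∈ Gal(ℚ̄_p/ℚ_p)` fixing the roots of unity of order prime to `p`, every `σ ∈ Aut(ℂ)` with `σ ι′ = ι′ τ`, and
every everywhere-unramified `χ` of infinity type `(n, −n)`, `n ≥ 1` (`𝔭` any prime of `K`). Proof = desc3's
`openValueReciprocityAtThree_of_archimedeanReciprocity` at a general prime: T6-OPEN gives a level `m`, `p ∤ m`, with
every `τ` fixing `μ_m` fixing `ι′⁻¹(F)`; an inertial `τ` fixes `μ_m`; so `σ` fixes `F`; then
`bdpInterpolationValue_exact_of_normalizedValue_exact` (`a_p(f) = a_p(W) ∈ ℤ`). CONDITIONAL on the named fact.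
[cite: BertoliniDarmonPrasanna2013, Thm. 5.5 and (5.1.16) (p. 60)] [cite: SerreLocalFields1979, Ch. IV §4 Prop. 16 and Cor. 1]
[cite: Castella2018, Thm. 3.1 (arXiv:1704.06608 p. 9)] -/
theorem inertialValueReciprocity_of_bdp2013 (hR : bertoliniDarmonPrasanna2013_centralValue_reciprocity)
    {p : ℕ} [Fact p.Prime] (hp2 : p ≠ 2) (ι' : PadicAlgCl p ≃+* ℂ) (W : WeierstrassCurve ℚ) [W.IsElliptic]
    (K : Type) [Field K] [NumberField K] {N : ℕ} [NeZero N] {f : CuspForm (CongruenceSubgroup.Gamma0 N) 2}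
    (hf : IsNewformOf W f) (hN : W.conductorNorm ℤ = N) (hKiq : IsImaginaryQuadratic K)
    (hodd : Odd (NumberField.discr K)) (hHeeg : SatisfiesHeegnerHypothesis N K)
    (hsplit : ((Ideal.span {(p : ℤ)}).primesOver (𝓞 K)).ncard = 2) (𝔭 : HeightOneSpectrum (𝓞 K)) :
    ∃ Ω : ℂ, Ω ≠ 0 ∧
      ∀ (τ : PadicAlgCl p ≃ₐ[ℚ_[p]] PadicAlgCl p) (σ : ℂ ≃ₐ[ℚ] ℂ),
        (∀ ζ : PadicAlgCl p, (∃ m : ℕ, 0 < m ∧ ¬ p ∣ m ∧ ζ ^ m = 1) → τ ζ = ζ) →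
        (∀ z : PadicAlgCl p, σ (ι' z) = ι' (τ z)) →
        ∀ (χ : HeckeCharacter K) (n : ℕ), 0 < n →
          (∀ v : HeightOneSpectrum (𝓞 K), χ.IsUnramifiedAt v) →
          ∀ hχ : χ.HasInfinityType (fun _ ↦ (n : ℤ)) (fun _ ↦ -(n : ℤ)),
            σ (bdpInterpolationValue p f 𝔭 χ n Ω) = bdpInterpolationValue p f 𝔭 (hχ.autConj σ) n Ω := by
  have hp : p.Prime := Fact.out
  obtain ⟨Ω, F, hΩ, hFd, -, hunrF, hexact⟩ := hR W K f hf hN hKiq hodd hHeeg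
  have hunrp : ∀ P : Ideal (𝓞 F), P.IsPrime → ((p : ℕ) : 𝓞 F) ∈ P → P.ramificationIdx (𝓞 ℚ) = 1 :=
    hunrF p hp hp2 hsplit
  obtain ⟨m, hm, hpm, hfix⟩ :=
    UnramifiedOpen.exists_level_forall_fixing_rootsOfUnity_apply_symm_eq p ι' F hFd hunrp
  refine ⟨Ω, hΩ, fun τ σ hτ hστ χ n hn hunrχ hχ ↦ ?_⟩
  have hτm : ∀ ζ : PadicAlgCl p, ζ ^ m = 1 → τ ζ = ζ := fun ζ hζ ↦ hτ ζ ⟨m, hm, hpm, hζ⟩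
  have hσF : ∀ x : ℂ, x ∈ F → σ x = x := fun x hx ↦ by
    have h := hστ (ι'.symm x)
    rwa [ι'.apply_symm_apply, hfix τ hτm x hx, ι'.apply_symm_apply] at h
  exact bdpInterpolationValue_exact_of_normalizedValue_exact p (exists_int_cuspCoeff_eq_of_isNewformOf hf p) 𝔭 hχ
    n Ω σ (hexact σ hσF χ n hn hunrχ hχ)

end Reciprocity

/-! ### §2 The `R₀`-frame at every classical datum, every odd `p ∣ N`, from the two named facts -/

section Frame

/-- **The BDP `R₀`-frame EXISTS at every classical datum, every odd `p ∣ N` — from Hsieh 2014 (period in `𝒲^×`)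
and BDP13 reciprocity, by descent.** Data: `p` odd; `W/ℚ` elliptic with newform `f` of level `N = N_W`, `p ∣ N`,
`p² ∤ N`; `K` imaginary quadratic of ODD discriminant with every `ℓ ∣ N` split (so `p` splits); `ι′ : ℚ̄_p ≃ ℂ` and
a prime `𝔭 ∋ p` of degree one with the compatibility clause `k ∈ 𝔭 ↔ ‖ι′⁻¹(w k)‖ < 1`; `κ` anticyclotomic with
topological generator `γ`. Conclusion: `∃ (Ω_K ≠ 0) (Ω_p ∈ R₀ˣ) (L ∈ R₀⟦T⟧), IsBDPLFunction ι′ 𝔭 κ γ f Ω_K Ω_p L` —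
the conclusion of A206 `castella2018_exists_isBDPLFunction` with NEITHER `Squarefree N` NOR `5 ≤ p`. Proof: the
λ-supply `X11b.lambdaSupplyAt` feeds Hsieh's fact (witness `(A, Ω_K, C, Ω_p ∈ R₀ˣ, Q)`); §1 gives the inertially
reciprocal period `Ω`; `exists_isBDPLFunction_of_inertialReciprocity_of_unrPeriodWitness` descends. CONDITIONAL on the
two named facts. [cite: Hsieh2014, Thm. 1 and Thm. 5.6 (arXiv:1112.1580 pp. 3–4, 23)]
[cite: BertoliniDarmonPrasanna2013, Thm. 5.5 and (5.1.16) (p. 60)] [cite: Castella2018, Thm. 3.1 (arXiv:1704.06608 p. 9)] -/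
theorem exists_isBDPLFunction_of_hsieh2014_unrPeriod_of_bdp2013
    (hH : hsieh2014_exists_anticyclotomicPAdicLFunction_unrPeriod)
    (hR : bertoliniDarmonPrasanna2013_centralValue_reciprocity)
    {p : ℕ} [Fact p.Prime] (hp2 : p ≠ 2) (ι' : PadicAlgCl p ≃+* ℂ) (W : WeierstrassCurve ℚ) [W.IsElliptic]
    (K : Type) [Field K] [NumberField K] (𝔭 : HeightOneSpectrum (𝓞 K)) (κ : ZpExtension K p)
    (γ : Field.absoluteGaloisGroup K) {N : ℕ} [NeZero N] {f : CuspForm (CongruenceSubgroup.Gamma0 N) 2}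
    (hf : IsNewformOf W f) (hN : W.conductorNorm ℤ = N) (hpN : p ∣ N) (hp2N : ¬ p ^ 2 ∣ N)
    (hKiq : IsImaginaryQuadratic K) (hodd : Odd (NumberField.discr K)) (hHeeg : SatisfiesHeegnerHypothesis N K)
    (hp𝔭 : ((p : ℕ) : 𝓞 K) ∈ 𝔭.asIdeal) (hram : 𝔭.asIdeal.ramificationIdx (𝓞 ℚ) = 1)
    (hdeg : 𝔭.asIdeal.inertiaDeg (𝓞 ℚ) = 1)
    (hι𝔭 : ∀ (w : InfinitePlace K) (k : 𝓞 K), k ∈ 𝔭.asIdeal ↔ ‖ι'.symm (w.embedding (k : K))‖ < 1)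
    (hκa : κ.IsAnticyclotomic) (hγ : κ.IsTopGenerator γ) :
    ∃ (ΩK : ℂ) (Ωp : (unrIntegers p)ˣ) (L : UnrSeries p), ΩK ≠ 0 ∧
      IsBDPLFunction ι' 𝔭 κ γ f ΩK ((Ωp : unrIntegers p) : ℂ_[p]) L := by
  have hp : p.Prime := Fact.out
  have hsplit : ((Ideal.span {(p : ℤ)}).primesOver (𝓞 K)).ncard = 2 := hHeeg p hp hpN
  -- the λ-supply at `(ι', K, κ)` (class field theory; tree theorem at every odd `p`)
  obtain ⟨lam, rlam, hunit, hinfl, hAQ, hunrl, havl, hfacl⟩ := lambdaSupplyAt hp2 ι' K κ hKiq hκa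
  -- Hsieh's witness with `Ω_p ∈ R₀ˣ`
  obtain ⟨A, ΩK, C, Ωp, Q, hA, hΩK, hC, hQ⟩ :=
    hH ι' K 𝔭 κ γ f lam rlam hp2 hf.1 hp2N hKiq hsplit hp𝔭 hι𝔭 hHeeg hunit hinfl hAQ hunrl havl hfacl hκa hγ
  -- the inertially reciprocal period
  obtain ⟨Ω, hΩ, hVRB⟩ := inertialValueReciprocity_of_bdp2013 hR hp2 ι' W K hf hN hKiq hodd hHeeg hsplit 𝔭
  exact exists_isBDPLFunction_of_inertialReciprocity_of_unrPeriodWitness hp2 ι' hpN hKiq hp𝔭 hram hdeg hκa hγ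
    Ωp hA hΩK hC hQ hΩ hVRB

end Frame

/-! ### §3 The registered stub `stub_bdpDatumNotRam` of crux 19282 on ALL (¬ram) pairs -/

section Stub

/-- **Stub `stub_bdpDatumNotRam` of crux `OpenInputNotRam` (item 19282) on ALL (¬ram) pairs — semistable or not —
from the TWO refereed named facts.** The registered signature VERBATIM (the skeleton-local `InducesPrimeAt p ι' 𝔭`
written out as its body), after the fact hypotheses `hH` (Hsieh 2014 Thm. 5.6 with `Ω_p ∈ 𝒲^×`) and `hR` (BDP13
Thm. 5.5): at every classical X11b datum of a (¬ram) pair there are `f = f_{Dt}`, a datum `ι'` inducing `𝔭`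
(`exists_datum_forall_mem_iff`), and an `R₀`-frame `(Ω_K ≠ 0, Ω_p ∈ R₀ˣ, L ∈ R₀⟦T⟧)` with
`IsBDPLFunction ι' 𝔭 κ γ f Ω_K Ω_p L` (`exists_isBDPLFunction_of_hsieh2014_unrPeriod_of_bdp2013`: `p ∣ N`, `p² ∤ N`
from `Mult`, `p ≠ 2` from `5 ≤ p`). The binders `¬ Ram W p`, `Surj`, `¬ p ∣ d_K`, `¬ p ∣ #𝓞_K^×`,
`L(E^{d_K},1) ≠ 0`, the point `P` are idle. CONDITIONAL on the two named facts; nothing booked; supersedes (on the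
non-semistable pairs) nothing and (on the semistable pairs) agrees with p462154's A206 road.
[cite: Hsieh2014, Thm. 1 and Thm. 5.6 (arXiv:1112.1580 pp. 3–4, 23)]
[cite: BertoliniDarmonPrasanna2013, Thm. 5.5 and (5.1.16) (p. 60)] [cite: Castella2018, Thm. 3.1 (arXiv:1704.06608 p. 9)] -/
theorem openInputNotRam_stub_bdpDatumNotRam_of_hsieh2014_unrPeriod_of_bdp2013
    (hH : hsieh2014_exists_anticyclotomicPAdicLFunction_unrPeriod)
    (hR : bertoliniDarmonPrasanna2013_centralValue_reciprocity) :
    ∀ (W : WeierstrassCurve ℚ) [W.IsElliptic] [W.IsGloballyMinimal] (p : ℕ) [Fact p.Prime]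
      (N : ℕ) [NeZero N] (K : Type) [Field K] [NumberField K]
      (Dt : ModularParametrizationData W N) (H : HeegnerDatum N (NumberField.discr K)) (ι : K →+* ℂ)
      (P : (W.baseChange K).toAffine.Point),
      ¬ Literature.NumberTheory.EllipticCurves.Rank1Residual.Ram W p →
      ClassX11b W p → 5 ≤ p → Surj W p → W.conductorNorm ℤ = N → IsImaginaryQuadratic K →
      Odd (NumberField.discr K) → ¬ (p : ℤ) ∣ NumberField.discr K → ¬ p ∣ Units.torsionOrder K →
      SatisfiesHeegnerHypothesis N K →
      (W.quadraticTwist (NumberField.discr K : ℚ)).entireLFunction 1 ≠ 0 →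
      WeierstrassCurve.Affine.Point.map ι.toRatAlgHom P = heegnerPointComplex Dt H →
      ¬ (p : ℤ) ∣ Dt.c → ¬ IsOfFinAddOrder P →
      ∀ (κ : ZpExtension K p), κ.IsAnticyclotomic →
        ∀ (γ : Field.absoluteGaloisGroup K) [Fact (κ.IsTopGenerator γ)]
          (𝔭 : HeightOneSpectrum (𝓞 K)), ((p : ℕ) : 𝓞 K) ∈ 𝔭.asIdeal →
          𝔭.asIdeal.ramificationIdx (𝓞 ℚ) = 1 → 𝔭.asIdeal.inertiaDeg (𝓞 ℚ) = 1 →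
          ∃ (f : CuspForm (CongruenceSubgroup.Gamma0 N) 2), IsNewformOf W f ∧
            ∃ ι' : PadicAlgCl p ≃+* ℂ,
              (∀ (w : InfinitePlace K) (k : 𝓞 K),
                k ∈ 𝔭.asIdeal ↔ ‖ι'.symm (w.embedding (k : K))‖ < 1) ∧
              ∃ (ΩK : ℂ) (Ωp : (unrIntegers p)ˣ) (L : UnrSeries p),
                ΩK ≠ 0 ∧ IsBDPLFunction ι' 𝔭 κ γ f ΩK ((Ωp : unrIntegers p) : ℂ_[p]) L := by
  intro W _ _ p _ N _ K _ _ Dt H ιK P _hnr hX h5 _hs hN hK hodd _hpd _hμ hHN _hLt _hP _hc _hPinf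
    κ hκ γ hγ 𝔭 h𝔭 he hf
  have hp2 : p ≠ 2 := by omega
  have hmult : Mult W p := hX.2.2.1
  have hpN : p ∣ N := hN ▸ dvd_conductorNorm_of_mult hmult
  have hp2N : ¬ p ^ 2 ∣ N := hN ▸ not_sq_dvd_conductorNorm_of_mult W p hmult
  -- an embedding datum inducing `𝔭` (one of `ι₀`, `ι₀ ∘ conj`)
  obtain ⟨ι₀⟩ := PadicAlgCl.nonempty_ringEquiv_complex p
  obtain ⟨ι', -, hι'⟩ := exists_datum_forall_mem_iff p ι₀ hK h𝔭
  obtain ⟨ΩK, Ωp, L, hΩK, hL⟩ := exists_isBDPLFunction_of_hsieh2014_unrPeriod_of_bdp2013 hH hR hp2 ι' W K 𝔭 κ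
    γ Dt.isNewformOf hN hpN hp2N hK hodd hHN h𝔭 he hf hι' hκ hγ.out
  exact ⟨Dt.f, Dt.isNewformOf, ι', hι', ΩK, Ωp, L, hΩK, hL⟩

end Stub

end Summit.BirchSwinnertonDyer.BirchSwinnertonDyer.Theorems

end
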